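import Summits.CriticalPhenomena.PercolationContinuityZ3.Theorems.PercNearOneGluingNoHeavyLowerTailStarSetFamilyA0
import Summits.CriticalPhenomena.PercolationContinuityZ3.Theorems.PercNearOneGluingNoHeavyLowerTailStarSetLoadSwap
import HarnessLib

/-!
# `NoHeavyLowerTail` (stmt-CriticalPhenomena-4575) — swap family: the triangle of a two-element fibre (U1-PROOF §5 L5.2/L5.3; blueprint §G3)

Support file (prover `prim-gen-swap` gen 13; `--supports stmt-CriticalPhenomena-4575`).  No definitions, no named facts, no sorries.

The data the assembly feeds to `familySwap_bound` for a target with two swap units: the two hubs `X = {d,a}`, `X' = {d,b}` through the common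
port `d` and the `d`-avoiding class `Y` adjacent to both form the r-free triangle on `{d, a, b}` (`swap_two_fibre_triangle`), and the class-set
capacity of a triangle dominates the sum of its two rotation words (`triangle_rotation_sum_le_cap`), hence `8·min(θ_X, θ_X')·θ_Y`
(`triangle_min_rotations_le_cap`, from `overflow_word_cap_ge`).

* `StarSet.triangle_rotation_sum_le_cap`, `StarSet.triangle_min_rotations_le_cap`, `StarSet.swap_two_fibre_triangle`.
-/

namespace Summit.CriticalPhenomena.PercolationContinuityZ3.Theorems

open Finset
open scoped BigOperators Classical

namespace StarSet

variable {ι V : Type*} [Fintype ι] [DecidableEq ι] [DecidableEq V]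

/-- **The class-set capacity of an r-free triangle dominates the sum of its two rotation words.**  `T = {X, Y, Z}` with port pairs
`ab, ac, bc` (`a, b, c` distinct, `≠ r`); rotations `(X→a, Y→c, Z→b)` and `(X→b, Y→a, Z→c)`. -/
theorem triangle_rotation_sum_le_cap (P P' : ι → V) (r : V) (O : ι → V → ℝ) (hO0 : ∀ X d, 0 ≤ O X d)
    {a b c : V} (hab : a ≠ b) (hac : a ≠ c) (hbc : b ≠ c) (har : a ≠ r) (hbr : b ≠ r) (hcr : c ≠ r)
    {X Y Z : ι} (hX : (s(P X, P' X) : Sym2 V) = s(a, b)) (hY : (s(P Y, P' Y) : Sym2 V) = s(a, c))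
    (hZ : (s(P Z, P' Z) : Sym2 V) = s(b, c)) :
    O X a * (O Y c * O Z b) + O X b * (O Y a * O Z c) ≤
      ∑ δ ∈ (univ : Finset (ι → Bool)).filter (fun δ => (∀ K ∉ ({X, Y, Z} : Finset ι), δ K = false) ∧
          3 ≤ (({X, Y, Z} : Finset ι).image fun K => if δ K then P K else P' K).card ∧
          r ∉ ({X, Y, Z} : Finset ι).image fun K => if δ K then P K else P' K),
        ∏ K ∈ ({X, Y, Z} : Finset ι), O K (if δ K then P K else P' K) := by
  -- distinct classes
  have hXY : X ≠ Y := by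
    intro h
    have h' : (s(a, b) : Sym2 V) = s(a, c) := by rw [← hX, ← hY, h]
    rcases Sym2.eq_iff.1 h' with ⟨_, h2⟩ | ⟨h1, _⟩
    · exact hbc h2
    · exact hac h1
  have hXZ : X ≠ Z := by
    intro h
    have h' : (s(a, b) : Sym2 V) = s(b, c) := by rw [← hX, ← hZ, h]
    rcases Sym2.eq_iff.1 h' with ⟨h1, _⟩ | ⟨h1, _⟩
    · exact hab h1
    · exact hac h1
  have hYZ : Y ≠ Z := by
    intro h
    have h' : (s(a, c) : Sym2 V) = s(b, c) := by rw [← hY, ← hZ, h]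
    rcases Sym2.eq_iff.1 h' with ⟨h1, _⟩ | ⟨h1, _⟩
    · exact hab h1
    · exact hac h1
  have hXnot : X ∉ ({Y, Z} : Finset ι) := by simp [hXY, hXZ]
  -- ports
  have hXa : P X = a ∨ P' X = a := (ports_iff_of_pair P P' hX a).2 (Or.inl rfl)
  have hXb : P X = b ∨ P' X = b := (ports_iff_of_pair P P' hX b).2 (Or.inr rfl)
  have hYa : P Y = a ∨ P' Y = a := (ports_iff_of_pair P P' hY a).2 (Or.inl rfl)
  have hYc : P Y = c ∨ P' Y = c := (ports_iff_of_pair P P' hY c).2 (Or.inr rfl)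
  have hZb : P Z = b ∨ P' Z = b := (ports_iff_of_pair P P' hZ b).2 (Or.inl rfl)
  have hZc : P Z = c ∨ P' Z = c := (ports_iff_of_pair P P' hZ c).2 (Or.inr rfl)
  -- the two rotations
  set ρ₁ : ι → Bool := fun K => if K = X then decide (P X = a) else if K = Y then decide (P Y = c)
    else if K = Z then decide (P Z = b) else false with hρ₁
  set ρ₂ : ι → Bool := fun K => if K = X then decide (P X = b) else if K = Y then decide (P Y = a)
    else if K = Z then decide (P Z = c) else false with hρ₂
  have hρ₁X : (if ρ₁ X then P X else P' X) = a := by simp only [hρ₁, if_pos rfl]; exact pick_port_eq P P' hXa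
  have hρ₁Y : (if ρ₁ Y then P Y else P' Y) = c := by
    simp only [hρ₁, if_neg hXY.symm]; exact pick_port_eq P P' hYc
  have hρ₁Z : (if ρ₁ Z then P Z else P' Z) = b := by
    simp only [hρ₁, if_neg hXZ.symm, if_neg hYZ.symm]; exact pick_port_eq P P' hZb
  have hρ₂X : (if ρ₂ X then P X else P' X) = b := by simp only [hρ₂, if_pos rfl]; exact pick_port_eq P P' hXb
  have hρ₂Y : (if ρ₂ Y then P Y else P' Y) = a := by
    simp only [hρ₂, if_neg hXY.symm]; exact pick_port_eq P P' hYa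
  have hρ₂Z : (if ρ₂ Z then P Z else P' Z) = c := by
    simp only [hρ₂, if_neg hXZ.symm, if_neg hYZ.symm]; exact pick_port_eq P P' hZc
  -- images
  have himg : ∀ (δ : ι → Bool) (x y z : V), (if δ X then P X else P' X) = x → (if δ Y then P Y else P' Y) = y →
      (if δ Z then P Z else P' Z) = z →
      (({X, Y, Z} : Finset ι).image fun K => if δ K then P K else P' K) = {x, y, z} := by
    intro δ x y z h1 h2 h3
    rw [image_insert, image_insert, image_singleton, h1, h2, h3]
  have hvalid : ∀ (δ : ι → Bool) (x y z : V), x ≠ y → x ≠ z → y ≠ z → x ≠ r → y ≠ r → z ≠ r →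
      (∀ K ∉ ({X, Y, Z} : Finset ι), δ K = false) →
      (if δ X then P X else P' X) = x → (if δ Y then P Y else P' Y) = y → (if δ Z then P Z else P' Z) = z →
      δ ∈ (univ : Finset (ι → Bool)).filter (fun δ => (∀ K ∉ ({X, Y, Z} : Finset ι), δ K = false) ∧
          3 ≤ (({X, Y, Z} : Finset ι).image fun K => if δ K then P K else P' K).card ∧
          r ∉ ({X, Y, Z} : Finset ι).image fun K => if δ K then P K else P' K) := by
    intro δ x y z hxy hxz hyz hxr hyr hzr hoff h1 h2 h3
    rw [mem_filter, himg δ x y z h1 h2 h3]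
    refine ⟨mem_univ _, hoff, ?_, ?_⟩
    · rw [card_insert_of_notMem (by simp [hxy, hxz]), card_pair hyz]
    · simp [Ne.symm hxr, Ne.symm hyr, Ne.symm hzr]
  have hoff₁ : ∀ K ∉ ({X, Y, Z} : Finset ι), ρ₁ K = false := by
    intro K hK
    simp only [mem_insert, mem_singleton, not_or] at hK
    simp only [hρ₁, if_neg hK.1, if_neg hK.2.1, if_neg hK.2.2]
  have hoff₂ : ∀ K ∉ ({X, Y, Z} : Finset ι), ρ₂ K = false := by
    intro K hK
    simp only [mem_insert, mem_singleton, not_or] at hK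
    simp only [hρ₂, if_neg hK.1, if_neg hK.2.1, if_neg hK.2.2]
  have hmem₁ := hvalid ρ₁ a c b hac hab (Ne.symm hbc) har hcr hbr hoff₁ hρ₁X hρ₁Y hρ₁Z
  have hmem₂ := hvalid ρ₂ b a c (Ne.symm hab) hbc hac hbr har hcr hoff₂ hρ₂X hρ₂Y hρ₂Z
  have hne : ρ₁ ≠ ρ₂ := by
    intro h
    have : (if ρ₁ X then P X else P' X) = (if ρ₂ X then P X else P' X) := by rw [h]
    rw [hρ₁X, hρ₂X] at this
    exact hab this
  -- the sum over all valid designations dominates the two rotations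
  have hsub : ({ρ₁, ρ₂} : Finset (ι → Bool)) ⊆ (univ : Finset (ι → Bool)).filter (fun δ =>
      (∀ K ∉ ({X, Y, Z} : Finset ι), δ K = false) ∧
        3 ≤ (({X, Y, Z} : Finset ι).image fun K => if δ K then P K else P' K).card ∧
        r ∉ ({X, Y, Z} : Finset ι).image fun K => if δ K then P K else P' K) := by
    intro δ hδ
    rcases mem_insert.1 hδ with rfl | hδ
    · exact hmem₁
    · rw [mem_singleton.1 hδ]; exact hmem₂
  refine le_trans ?_ (sum_le_sum_of_subset_of_nonneg hsub fun δ _ _ => prod_nonneg fun K _ => hO0 _ _)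
  rw [sum_pair hne, prod_insert hXnot, prod_pair hYZ, prod_insert hXnot, prod_pair hYZ,
    hρ₁X, hρ₁Y, hρ₁Z, hρ₂X, hρ₂Y, hρ₂Z]

/-- **`8·min(θ_X, θ_Y)·θ_Z ≤ C_T` for an r-free triangle** `T = {X, Y, Z}` (port pairs `ab, ac, bc`): the overflow-stream capacity of
U1-PROOF L5.3 (`overflow_word_cap_ge`) embedded into the class-set capacity. -/
theorem triangle_min_rotations_le_cap (P P' : ι → V) (r : V)
    (θ : ι → ℝ) (hθ0 : ∀ X, 0 ≤ θ X) (O : ι → V → ℝ) (hO0 : ∀ X d, 0 ≤ O X d) (Φ : ι → ℝ)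
    (hO2 : ∀ X, Φ X ^ 2 ≤ O X (P X) * O X (P' X)) (hΦ4 : ∀ X, 4 * θ X ≤ Φ X) (hΦsq : ∀ X, θ X ≤ Φ X ^ 2)
    {a b c : V} (hab : a ≠ b) (hac : a ≠ c) (hbc : b ≠ c) (har : a ≠ r) (hbr : b ≠ r) (hcr : c ≠ r)
    {X Y Z : ι} (hX : (s(P X, P' X) : Sym2 V) = s(a, b)) (hY : (s(P Y, P' Y) : Sym2 V) = s(a, c))
    (hZ : (s(P Z, P' Z) : Sym2 V) = s(b, c)) :
    8 * (min (θ X) (θ Y) * θ Z) ≤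
      ∑ δ ∈ (univ : Finset (ι → Bool)).filter (fun δ => (∀ K ∉ ({X, Y, Z} : Finset ι), δ K = false) ∧
          3 ≤ (({X, Y, Z} : Finset ι).image fun K => if δ K then P K else P' K).card ∧
          r ∉ ({X, Y, Z} : Finset ι).image fun K => if δ K then P K else P' K),
        ∏ K ∈ ({X, Y, Z} : Finset ι), O K (if δ K then P K else P' K) := by
  refine le_trans ?_ (triangle_rotation_sum_le_cap P P' r O hO0 hab hac hbc har hbr hcr hX hY hZ)
  have hΦ0 : ∀ K, 0 ≤ Φ K := fun K => by linarith [hΦ4 K, hθ0 K]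
  -- rotation 1 = (X→a, Y→c, Z→b), rotation 2 = (X→b, Y→a, Z→c): complementary per class
  have h := overflow_word_cap_ge (θ X) (θ Y) (θ Z) (Φ X) (Φ Y) (Φ Z) (O X a) (O X b) (O Y c) (O Y a) (O Z b) (O Z c)
    (hθ0 X) (hθ0 Y) (hθ0 Z) (hΦ0 X) (hΦ0 Y) (hΦ4 Z) (hΦsq X) (hΦsq Y)
    (hO0 _ _) (hO0 _ _) (hO0 _ _) (hO0 _ _) (hO0 _ _) (hO0 _ _)
    (odds_pair_of_ports P P' O Φ hX (hO2 X)) ?_ (odds_pair_of_ports P P' O Φ hZ (hO2 Z))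
  · nlinarith [h, hO0 X a, hO0 X b]
  · rw [mul_comm]; exact odds_pair_of_ports P P' O Φ hY (hO2 Y)

omit [Fintype ι] [DecidableEq ι] [DecidableEq V] in
/-- **The triangle of a two-element swap fibre (U1-PROOF L5.2).**  Two distinct classes `X, X'` through a common port `d`, and a class `Y`
avoiding `d` adjacent to both: then `X = {d,a}`, `X' = {d,b}`, `Y = {a,b}` with `a ≠ b` (both `≠ d`). -/
theorem swap_two_fibre_triangle (P P' : ι → V) (hPP' : ∀ X, P X ≠ P' X)
    (hinj : Function.Injective fun X => (s(P X, P' X) : Sym2 V)) {X X' Y : ι} (hXX' : X ≠ X') {d : V}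
    (hdX : P X = d ∨ P' X = d) (hdX' : P X' = d ∨ P' X' = d) (hYd : P Y ≠ d ∧ P' Y ≠ d)
    (hXY : P X = P Y ∨ P X = P' Y ∨ P' X = P Y ∨ P' X = P' Y)
    (hX'Y : P X' = P Y ∨ P X' = P' Y ∨ P' X' = P Y ∨ P' X' = P' Y) :
    ∃ a b : V, a ≠ b ∧ d ≠ a ∧ d ≠ b ∧ (s(P X, P' X) : Sym2 V) = s(d, a) ∧ (s(P X', P' X') : Sym2 V) = s(d, b) ∧
      (s(P Y, P' Y) : Sym2 V) = s(a, b) := by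
  -- the other ports
  obtain ⟨a, hda, hXa⟩ : ∃ a, d ≠ a ∧ (P X = a ∨ P' X = a) ∧ (P Y = a ∨ P' Y = a) := by
    rcases hdX with h | h
    · refine ⟨P' X, by rw [← h]; exact hPP' X, Or.inr rfl, ?_⟩
      rcases hXY with h' | h' | h' | h'
      · exact absurd (h.symm.trans h').symm hYd.1
      · exact absurd (h.symm.trans h').symm hYd.2
      · exact Or.inl h'.symm
      · exact Or.inr h'.symm
    · refine ⟨P X, by rw [← h]; exact (hPP' X).symm, Or.inl rfl, ?_⟩
      rcases hXY with h' | h' | h' | h'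
      · exact Or.inl h'.symm
      · exact Or.inr h'.symm
      · exact absurd (h.symm.trans h').symm hYd.1
      · exact absurd (h.symm.trans h').symm hYd.2
  obtain ⟨b, hdb, hX'b⟩ : ∃ b, d ≠ b ∧ (P X' = b ∨ P' X' = b) ∧ (P Y = b ∨ P' Y = b) := by
    rcases hdX' with h | h
    · refine ⟨P' X', by rw [← h]; exact hPP' X', Or.inr rfl, ?_⟩
      rcases hX'Y with h' | h' | h' | h'
      · exact absurd (h.symm.trans h').symm hYd.1
      · exact absurd (h.symm.trans h').symm hYd.2
      · exact Or.inl h'.symm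
      · exact Or.inr h'.symm
    · refine ⟨P X', by rw [← h]; exact (hPP' X').symm, Or.inl rfl, ?_⟩
      rcases hX'Y with h' | h' | h' | h'
      · exact Or.inl h'.symm
      · exact Or.inr h'.symm
      · exact absurd (h.symm.trans h').symm hYd.1
      · exact absurd (h.symm.trans h').symm hYd.2
  have hXpair : (s(P X, P' X) : Sym2 V) = s(d, a) := sym2_eq_of_mem_of_mem hda hdX hXa.1
  have hX'pair : (s(P X', P' X') : Sym2 V) = s(d, b) := sym2_eq_of_mem_of_mem hdb hdX' hX'b.1
  have hab : a ≠ b := by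
    intro h
    apply hXX'
    apply hinj
    show (s(P X, P' X) : Sym2 V) = s(P X', P' X')
    rw [hXpair, hX'pair, h]
  exact ⟨a, b, hab, hda, hdb, hXpair, hX'pair, sym2_eq_of_mem_of_mem hab hXa.2 hX'b.2⟩

end StarSet

end Summit.CriticalPhenomena.PercolationContinuityZ3.Theorems
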